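import Mathlib
import HarnessLib

/-!
# Route `FlowLineStateSpace`, support ⟨stmt-QuantumFields-14707⟩ `EntropyNonConcentrationFromUI` — helper 2/3:
# Gaussian weight sums on the discrete torus

The entropy functional of the item weights the sites `y` of the torus `(ℤ/L)ᵈ` by `exp(−d(x,y)²/a)`, `d` the periodic distance
(`d(x,y)² = Σᵢ min(|xᵢ−yᵢ|, L−|xᵢ−yᵢ|)²`) and `a = 4R²t₀`.  We bound the total weight, uniformly in `L` and `x`:

* `sum_exp_neg_sq_div_le` — `Σ_{m=1}^{M} e^{−m²/a} ≤ √(πa)/2` (sum ≤ Gaussian half-line integral);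
* `torusGaussian_sum_one_le` — one coordinate: `Σ_{w ∈ ℤ/L} e^{−min(w, L−w)²/a} ≤ 1 + √(πa)`;
* `torusGaussian_sum_le` — `Σ_y e^{−d(x,y)²/a} ≤ (1 + √(πa))ᵈ` (translate `y ↦ x − y`, factorise over coordinates).

Mathlib only; THEOREMS ONLY; no `sorry`.  HONEST LABEL: elementary bookkeeping for ONE support item; nothing about the crux, rung or
summit; the Yang–Mills mass gap is NOT proved.  Width seat `ym-line-sfw-p2-w3` g34 (cell ym-idea-1, free hands),
`--supports stmt-QuantumFields-14707`.
-/

set_option autoImplicit false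

namespace Summit.QuantumFields.YangMills.Theorems.FlowLineStateSpaceEntropy

open Real Set MeasureTheory
open scoped BigOperators

/-- `Σ_{m=1}^{M} e^{−m²/a} ≤ √(πa)/2` for `a > 0`: the summands are the values at the right end points of unit intervals of an
antitone function, so the sum is at most `∫₀^∞ e^{−s²/a} ds = √(πa)/2`. [folklore] -/
theorem sum_exp_neg_sq_div_le {a : ℝ} (ha : 0 < a) (M : ℕ) :
    ∑ i ∈ Finset.range M, Real.exp (-((i + 1 : ℕ) : ℝ) ^ 2 / a) ≤ Real.sqrt (Real.pi * a) / 2 := by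
  set f : ℝ → ℝ := fun s => Real.exp (-(1 / a) * s ^ 2) with hf
  have hanti : AntitoneOn f (Icc (0 : ℝ) ((0 : ℝ) + M)) := by
    intro s hs t _ hst
    simp only [hf]
    refine Real.exp_le_exp.mpr ?_
    have hs0 : 0 ≤ s := hs.1
    have : s ^ 2 ≤ t ^ 2 := by nlinarith
    have h1a : 0 ≤ 1 / a := by positivity
    nlinarith
  have h1 := AntitoneOn.sum_le_integral hanti
  have h2 : ∑ i ∈ Finset.range M, Real.exp (-((i + 1 : ℕ) : ℝ) ^ 2 / a) =
      ∑ i ∈ Finset.range M, f ((0 : ℝ) + ((i + 1 : ℕ) : ℝ)) := by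
    refine Finset.sum_congr rfl fun i _ => ?_
    simp only [hf, zero_add]
    congr 1
    ring
  rw [h2]
  refine h1.trans ?_
  have hint : Integrable f := integrable_exp_neg_mul_sq (by positivity : 0 < 1 / a)
  have hnn : ∀ s, 0 ≤ f s := fun s => (Real.exp_pos _).le
  have h3 : ∫ x in (0 : ℝ)..(0 : ℝ) + M, f x ≤ ∫ x in Ioi (0 : ℝ), f x := by
    rw [intervalIntegral.integral_of_le (by positivity)]
    exact setIntegral_mono_set hint.integrableOn (Filter.Eventually.of_forall hnn)
      (Filter.Eventually.of_forall Ioc_subset_Ioi_self)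
  refine h3.trans (le_of_eq ?_)
  rw [hf, integral_gaussian_Ioi (1 / a), one_div, div_inv_eq_mul]

/-- One coordinate of the torus: `Σ_{w ∈ ℤ/L} e^{−min(w, L−w)²/a} ≤ 1 + √(πa)` (`min` is one of its two arguments; each of the two
resulting sums is `1 + Σ_{m≥1}` resp. `Σ_{m≥1}` of `e^{−m²/a}`). [folklore] -/
theorem torusGaussian_sum_one_le (L : ℕ) [NeZero L] {a : ℝ} (ha : 0 < a) :
    ∑ w : ZMod L, Real.exp (-((min w.val (L - w.val) : ℕ) : ℝ) ^ 2 / a) ≤ 1 + Real.sqrt (Real.pi * a) := by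
  obtain ⟨n, hn⟩ := Nat.exists_eq_succ_of_ne_zero (NeZero.ne L)
  subst hn
  -- `ZMod (n+1) = Fin (n+1)` and `val` is the coercion
  have hsum : ∑ w : ZMod n.succ, Real.exp (-((min w.val (n.succ - w.val) : ℕ) : ℝ) ^ 2 / a) =
      ∑ w : Fin (n + 1), Real.exp (-((min (w : ℕ) (n + 1 - w) : ℕ) : ℝ) ^ 2 / a) := rfl
  rw [hsum]
  have hle : ∀ w : Fin (n + 1), Real.exp (-((min (w : ℕ) (n + 1 - w) : ℕ) : ℝ) ^ 2 / a) ≤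
      Real.exp (-((w : ℕ) : ℝ) ^ 2 / a) + Real.exp (-((n + 1 - w : ℕ) : ℝ) ^ 2 / a) := by
    intro w
    rcases min_choice (w : ℕ) (n + 1 - w) with h | h
    · rw [h]
      exact le_add_of_nonneg_right (Real.exp_pos _).le
    · rw [h]
      exact le_add_of_nonneg_left (Real.exp_pos _).le
  refine (Finset.sum_le_sum fun w _ => hle w).trans ?_
  rw [Finset.sum_add_distrib]
  -- first sum: `m = 0, …, n`: `1 + Σ_{m=1}^{n}`
  have hA : ∑ w : Fin (n + 1), Real.exp (-((w : ℕ) : ℝ) ^ 2 / a) ≤ 1 + Real.sqrt (Real.pi * a) / 2 := by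
    rw [Fin.sum_univ_succ]
    simp only [Fin.val_zero, Nat.cast_zero, ne_eq, OfNat.ofNat_ne_zero, not_false_eq_true, zero_pow, neg_zero,
      zero_div, Real.exp_zero, Fin.val_succ]
    have := sum_exp_neg_sq_div_le ha n
    rw [Finset.sum_range] at this
    linarith
  -- second sum: `m = n+1, …, 1`
  have hB : ∑ w : Fin (n + 1), Real.exp (-((n + 1 - w : ℕ) : ℝ) ^ 2 / a) ≤ Real.sqrt (Real.pi * a) / 2 := by
    have hre : ∑ w : Fin (n + 1), Real.exp (-((n + 1 - w : ℕ) : ℝ) ^ 2 / a) =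
        ∑ i ∈ Finset.range (n + 1), Real.exp (-((i + 1 : ℕ) : ℝ) ^ 2 / a) := by
      rw [Finset.sum_range]
      -- reflect `w ↦ n - w`
      refine Fintype.sum_equiv Fin.revPerm _ _ fun w => ?_
      have hw := w.isLt
      have hcast : (n + 1 - (w : ℕ) : ℕ) = (n + 1 - ((w : ℕ) + 1) + 1 : ℕ) := by
        rw [Nat.add_sub_add_right, Nat.sub_add_comm (Nat.le_of_lt_succ hw)]
      simp only [Fin.revPerm_apply, Fin.val_rev, hcast]
    rw [hre]
    exact sum_exp_neg_sq_div_le ha (n + 1)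
  linarith

/-- **Gaussian weight sums on the discrete torus**: for every `x ∈ (ℤ/L)ᵈ` and `a > 0`,
`Σ_y exp(−Σᵢ min(|xᵢ−yᵢ|, L−|xᵢ−yᵢ|)²/a) ≤ (1 + √(πa))ᵈ`. [folklore] -/
theorem torusGaussian_sum_le (d L : ℕ) [NeZero L] (x : Fin d → ZMod L) {a : ℝ} (ha : 0 < a) :
    ∑ y : Fin d → ZMod L, Real.exp (-(∑ i : Fin d,
        ((min (x i - y i).val (L - (x i - y i).val) : ℕ) : ℝ) ^ 2) / a) ≤ (1 + Real.sqrt (Real.pi * a)) ^ d := by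
  -- translate `y ↦ x − y`
  have h1 : ∑ y : Fin d → ZMod L, Real.exp (-(∑ i : Fin d,
        ((min (x i - y i).val (L - (x i - y i).val) : ℕ) : ℝ) ^ 2) / a) =
      ∑ z : Fin d → ZMod L, Real.exp (-(∑ i : Fin d, ((min (z i).val (L - (z i).val) : ℕ) : ℝ) ^ 2) / a) := by
    refine Fintype.sum_equiv (Equiv.subLeft x) _ _ fun y => ?_
    simp only [Equiv.subLeft_apply, Pi.sub_apply]
  rw [h1]
  -- factorise the exponential over coordinates
  have h2 : ∀ z : Fin d → ZMod L, Real.exp (-(∑ i : Fin d, ((min (z i).val (L - (z i).val) : ℕ) : ℝ) ^ 2) / a) =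
      ∏ i : Fin d, Real.exp (-((min (z i).val (L - (z i).val) : ℕ) : ℝ) ^ 2 / a) := by
    intro z
    rw [← Real.exp_sum]
    congr 1
    rw [← Finset.sum_neg_distrib, Finset.sum_div]
  simp only [h2]
  rw [← Fintype.prod_sum (fun (i : Fin d) (w : ZMod L) => Real.exp (-((min w.val (L - w.val) : ℕ) : ℝ) ^ 2 / a))]
  simp only [Finset.prod_const, Finset.card_univ, Fintype.card_fin]
  exact pow_le_pow_left₀ (Finset.sum_nonneg fun w _ => (Real.exp_pos _).le) (torusGaussian_sum_one_le L ha) d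

end Summit.QuantumFields.YangMills.Theorems.FlowLineStateSpaceEntropy
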